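import Mathlib
import HarnessLib

/-!
# The determinant of a matrix whose rows are integrals: `det ∫ = ∫ det` and the row-averaging bound

Topic `Analysis/Matrix`.  Multilinearity of the determinant in its rows, in integral form: if every entry of row `i` of a square
matrix is the integral over ONE variable `x_i` (common to the row) of a kernel, `M i j = ∫ A i j x ∂μ`, then
`det M = ∫ det [A i j (x i)] ∂(μ ⊗ ⋯ ⊗ μ)` over the product of the row variables (Leibniz' formula and Fubini for finite products,
`MeasureTheory.integral_fintype_prod_eq_prod`), and consequently a determinant bound `‖det [A i j (x i)]‖ ≤ B` uniform in the
row variables together with `L¹` weights `φ_i` gives `‖det [∫ φ_i(x) A i j x dx]‖ ≤ B ∏_i ‖φ_i‖₁`.  This is the device by which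
determinant bounds for time-ordered kernels (de Siqueira Pedra–Salmhofer 2008, Thm 1.3 / Thm 2.4) pass to their smooth frequency
truncations — a smooth truncation of an antiperiodic kernel is a row-average of its time translates (loc. cit. §2, (2.8)–(2.10):
"the covariance with a smooth cutoff is a superposition …").

* `det_of_row_integral` — `det [∫ A i j ∂μ] = ∫ det [A i j (x i)] ∂(Measure.pi μ)` for integrable entries;
* **`norm_det_row_integral_le`** — with weights: `‖det [∫ φ_i · A i j ∂μ]‖ ≤ B ∏_i ∫ ‖φ_i‖ ∂μ` when
  `‖det [A i j (x i)]‖ ≤ B` for all row variables and the `A i j` are bounded and (ae strongly) measurable.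

Everything is PROVED; no definition, no named fact.

## References

* W. de Siqueira Pedra, M. Salmhofer, Comm. Math. Phys. 282 (2008) 797–818, §2 (2.8)–(2.10), Thm 1.3. [PedraSalmhofer2008]
-/

noncomputable section

open MeasureTheory Finset

namespace Literature.Analysis.Matrix

variable {𝕜 : Type*} [RCLike 𝕜] {X : Type*} [MeasurableSpace X] {n : ℕ}

/-- **`det ∫ = ∫ det` (rows integrated in independent variables).**  For a square matrix whose `(i, j)` entry is
`∫ A i j x ∂μ`, with every `A i j` integrable: `det M = ∫ det [A i j (x i)] ∂(Measure.pi fun _ => μ)` — Leibniz' formula, then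
Fubini for the product over the rows (`integral_fintype_prod_eq_prod`). [cite: PedraSalmhofer2008, §2 (2.8)-(2.10)] -/
theorem det_of_row_integral (μ : Measure X) [SigmaFinite μ] (A : Fin n → Fin n → X → 𝕜)
    (hA : ∀ i j, Integrable (A i j) μ) :
    (Matrix.of fun i j : Fin n => ∫ x, A i j x ∂μ).det =
      ∫ x : Fin n → X, (Matrix.of fun i j : Fin n => A i j (x i)).det ∂(Measure.pi fun _ => μ) := by
  classical
  -- Leibniz on both sides, rows indexed by the permuted index
  simp only [Matrix.det_apply', Matrix.of_apply]
  -- each summand: `∏ i, ∫ A (σ i) i = ∫ ∏ i, A (σ i) i (x (σ i))`, after reindexing the product by rows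
  have hterm : ∀ σ : Equiv.Perm (Fin n), (∏ i, ∫ x, A (σ i) i x ∂μ) =
      ∫ x : Fin n → X, ∏ i, A (σ i) i (x (σ i)) ∂(Measure.pi fun _ => μ) := by
    intro σ
    -- reindex `∏ i, f (σ i) i = ∏ r, f r (σ⁻¹ r)`
    have h1 : (∏ i, ∫ x, A (σ i) i x ∂μ) = ∏ r, ∫ x, A r (σ.symm r) x ∂μ := by
      rw [← Equiv.prod_comp σ.symm]
      simp only [Equiv.apply_symm_apply]
    have h2 : (fun x : Fin n → X => ∏ i, A (σ i) i (x (σ i))) = fun x => ∏ r, A r (σ.symm r) (x r) := by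
      funext x
      rw [← Equiv.prod_comp σ.symm]
      simp only [Equiv.apply_symm_apply]
    rw [h1, h2, integral_fintype_prod_eq_prod]
  -- integrability of the summands on the product space
  have hint : ∀ σ : Equiv.Perm (Fin n),
      Integrable (fun x : Fin n → X => ∏ i, A (σ i) i (x (σ i))) (Measure.pi fun _ => μ) := by
    intro σ
    have h2 : (fun x : Fin n → X => ∏ i, A (σ i) i (x (σ i))) = fun x => ∏ r, A r (σ.symm r) (x r) := by
      funext x
      rw [← Equiv.prod_comp σ.symm]
      simp only [Equiv.apply_symm_apply]
    rw [h2]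
    exact Integrable.fintype_prod (f := fun r => A r (σ.symm r)) fun r => hA r _
  rw [integral_finsetSum _ fun σ _ => (hint σ).const_mul _]
  refine sum_congr rfl fun σ _ => ?_
  rw [integral_const_mul, hterm σ]

/-- **The row-averaging bound.**  Let `φ_i : X → 𝕜` be integrable weights and `A i j : X → 𝕜` kernels with `φ_i · A i j` integrable
on a σ-finite measure space, such that the determinant with the row variables frozen is bounded: `‖det [A i j (x i)]‖ ≤ B` for all
`x : Fin n → X`.  Then the matrix of row averages `M i j = ∫ φ_i x · A i j x ∂μ` has `‖det M‖ ≤ B · ∏_i ∫ ‖φ_i‖ ∂μ`.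
[cite: PedraSalmhofer2008, Thm 1.3] -/
theorem norm_det_row_integral_le (μ : Measure X) [SigmaFinite μ] (φ : Fin n → X → 𝕜) (A : Fin n → Fin n → X → 𝕜)
    (hφ : ∀ i, Integrable (φ i) μ) (hφA : ∀ i j, Integrable (fun x => φ i x * A i j x) μ)
    {B : ℝ} (hdet : ∀ x : Fin n → X, ‖(Matrix.of fun i j : Fin n => A i j (x i)).det‖ ≤ B) :
    ‖(Matrix.of fun i j : Fin n => ∫ x, φ i x * A i j x ∂μ).det‖ ≤ B * ∏ i, ∫ x, ‖φ i x‖ ∂μ := by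
  classical
  rw [det_of_row_integral μ (fun i j x => φ i x * A i j x) hφA]
  -- `det [φ_i(x_i) A i j (x_i)] = (∏ φ_i(x_i)) · det [A i j (x_i)]`
  have hscale : ∀ x : Fin n → X, (Matrix.of fun i j : Fin n => φ i (x i) * A i j (x i)).det =
      (∏ i, φ i (x i)) * (Matrix.of fun i j : Fin n => A i j (x i)).det := by
    intro x
    have h := Matrix.det_mul_column (fun i => φ i (x i)) (Matrix.of fun i j : Fin n => A i j (x i))
    simpa only [Matrix.of_apply] using h
  simp_rw [hscale]
  -- the dominating function `B ∏ ‖φ_i(x_i)‖` is integrable with integral `B ∏ ∫‖φ_i‖`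
  have hdom : Integrable (fun x : Fin n → X => ∏ i, ‖φ i (x i)‖) (Measure.pi fun _ => μ) :=
    Integrable.fintype_prod (𝕜 := ℝ) (f := fun i y => ‖φ i y‖) fun i => (hφ i).norm
  calc ‖∫ x : Fin n → X, (∏ i, φ i (x i)) * (Matrix.of fun i j : Fin n => A i j (x i)).det ∂(Measure.pi fun _ => μ)‖
      ≤ ∫ x : Fin n → X, ‖(∏ i, φ i (x i)) * (Matrix.of fun i j : Fin n => A i j (x i)).det‖ ∂(Measure.pi fun _ => μ) :=
        norm_integral_le_integral_norm _
    _ ≤ ∫ x : Fin n → X, (∏ i, ‖φ i (x i)‖) * B ∂(Measure.pi fun _ => μ) := by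
        refine integral_mono_of_nonneg (Filter.Eventually.of_forall fun x => norm_nonneg _) (hdom.mul_const B)
          (Filter.Eventually.of_forall fun x => ?_)
        dsimp only
        rw [norm_mul, norm_prod]
        exact mul_le_mul_of_nonneg_left (hdet x) (prod_nonneg fun i _ => norm_nonneg _)
    _ = B * ∏ i, ∫ x, ‖φ i x‖ ∂μ := by
        rw [integral_mul_const, integral_fintype_prod_eq_prod (𝕜 := ℝ) (f := fun i y => ‖φ i y‖), mul_comm]

end Literature.Analysis.Matrix

end
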